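import Literature.NumberTheory.LFunctions.RayClassLSeriesLogDerivLocal
import Literature.NumberTheory.LFunctions.RayClassLSeriesDirichlet
import Literature.NumberTheory.LFunctions.RayClassLSeriesNonvanishingLineProofs
import Literature.NumberTheory.LFunctions.RayClassConductor
import Literature.NumberTheory.LFunctions.LogFreeLocalAbstract
import Literature.NumberTheory.LFunctions.LogFreeDensityLemmaA
import HarnessLib

/-!
# Local data of the entire Hecke `L`-function of a ray class character and Bombieri's Lemme A

Topic `Literature/NumberTheory/LFunctions`, namespace `Literature.NumberTheory.LFunctions`.
Everything here is PROVED (one structure + two definitions with bodies, theorems; no named facts).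

The ray-class analogue of the tree's `ClassGroupLFunctionLocalL0.lean` + `ClassGroupLogFreeLemmaA.lean` (conductor
`1`).  For a ray class character `ψ mod 𝔪 ≠ 0` of the number field `K` (`n = n_K`), non-principal on the primes
`∤ 𝔪`, we package its PRIMITIVE ASSOCIATE `χ₀ mod 𝔣` (`𝔣 ∣ 𝔪`, sign type `p`; `exists_primitive_associate`)
together with the entire continuation `L` of `L(s, χ₀)` (Hecke; `exists_continuation_norm_le`) as a
`RayClassPrimitiveData 𝔪 ψ` (obtained by choice: `rayClassPrimitiveData`); the zeros of `L_𝔪(s, ψ)` with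
`Re s > 0` are those of `L`.  With `c = 2 + iv` and the height
`ℳ = rayDiscBound K 𝔪 v = log(|d_K| N𝔪) + 3n + n log(|v|+7)` (`≥` the same with `N𝔣`):
* `L_ne_zero_of_one_le_re` — `L(s) ≠ 0` for `Re s ≥ 1` (Euler product; Hecke–Landau on `Re s = 1`);
* `sum_discDivisor_le` — Jensen: `Σ_{|ρ−c| ≤ 31/16} m(ρ) ≤ 32 ℳ`; `norm_logDeriv_sub_sum_le` — the local
  partial fraction `|L'/L(s) − Σ_{|ρ−c| ≤ 31/16} m(ρ)/(s−ρ)| ≤ 77760 ℳ` for `|s − c| ≤ 7/4`, `L(s) ≠ 0`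
  (Lagarias–Odlyzko Lemma 5.6, tree `RayClassLSeriesLogDerivLocal`); `norm_logDeriv_le` —
  `|L'/L(s)| ≤ 1/(σ−1) + 77760(5n+2)(log|d_K| + log 4)` for `1 < σ ≤ 2`;
* `localCount_le` — Lemme de densité: `Σ_{|ρ−(1+iv)| ≤ λ} m(ρ) ≤ 4(1 + λ ℒ')`, `ℒ' = rayLemmaAHeight K 𝔪 v`;
* `lemmeA_rayClass` — **Bombieri's Lemme A for Hecke `L`-functions of ray class characters**, uniformly in
  `K`, `𝔪`, `ψ`: an absolute `c₄ > 0` such that a zero `ρ₀` with `|ρ₀ − (1+iv)| ≤ r` (`512r ≤ 1/8`, `rL' ≥ 1`,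
  `L' ≥ ℒ'`) forces `‖(L'/L)^{(k)}(1+r+iv)‖/k! ≥ e^{−10K'}(2r)^{−(k+1)}` for some `k ∈ [K', 2K']`, every
  `K' ≥ c₄ rL' + 2`.

## References
* [Bombieri1987GrandCrible] E. Bombieri, *Le grand crible dans la théorie analytique des nombres*, Astérisque 18
  (1987), §6, Lemme de densité and Lemme A, pp. 42–45.
* [LagariasOdlyzko1977] J. C. Lagarias, A. M. Odlyzko, *Effective versions of the Chebotarev density theorem*
  (1977), Lemma 5.6.
* [ThornerZaman2017] J. Thorner, A. Zaman, Algebra Number Theory 11 (2017), §5.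
* [Weiss1983] A. Weiss, J. reine angew. Math. 338 (1983), §4.
-/

noncomputable section

open Complex Metric Set Filter Finset MeromorphicOn NumberField NumberField.InfinitePlace IsDedekindDomain
open scoped Real Topology NumberField

namespace Literature.NumberTheory.LFunctions

open Literature.NumberTheory.LFunctions.LogFreeLocal Literature.NumberTheory.LFunctions.LogFreeDensity
open scoped nonZeroDivisors Classical

variable {K : Type*} [Field K] [NumberField K]

/-! ### The primitive associate and its entire `L`-function -/

/-- **The primitive associate of a ray class character `ψ mod 𝔪` with its entire `L`-function**: a divisor
`𝔣 ∣ 𝔪`, a primitive ray class character `χ₀ mod 𝔣` of sign type `p` agreeing with `ψ` on the primes `∤ 𝔪`,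
with `L_𝔪(s, ψ) = L(s, χ₀) ∏_{𝔭∣𝔪, 𝔭∤𝔣}(1 − χ₀(𝔭)N𝔭^{-s})` (`Re s > 1`), and the entire continuation `L` of
`L(s, χ₀)` (Neukirch VII §6 p. 472, §8 (8.5)–(8.6)). [cite: NeukirchANT1999, Ch. VII §8 Thm. (8.5)] -/
structure RayClassPrimitiveData (𝔪 : Ideal (𝓞 K)) (ψ : HeightOneSpectrum (𝓞 K) → ℂ) where
  /-- the conductor -/
  𝔣 : Ideal (𝓞 K)
  /-- the primitive associate `mod 𝔣` -/
  χ₀ : HeightOneSpectrum (𝓞 K) → ℂ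
  /-- its sign type -/
  p : Finset {w : InfinitePlace K // IsReal w}
  /-- the entire continuation of `L(s, χ₀)` -/
  L : ℂ → ℂ
  modulus_ne_bot : 𝔪 ≠ ⊥
  le : 𝔪 ≤ 𝔣
  ne_bot : 𝔣 ≠ ⊥
  isRayClassCharacter : IsRayClassCharacter 𝔣 χ₀
  isPrimitive : IsPrimitive 𝔣 χ₀
  isSignType : IsSignType 𝔣 χ₀ p
  agree : ∀ v : HeightOneSpectrum (𝓞 K), ¬ 𝔪 ≤ v.asIdeal → χ₀ v = ψ v
  lseries_eq : ∀ s : ℂ, 1 < s.re → rayClassLSeries 𝔪 ψ s = rayClassLSeries 𝔣 χ₀ s *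
    ∏ v ∈ (Ideal.finite_factors modulus_ne_bot).toFinset.filter (fun v ↦ ¬ 𝔣 ≤ v.asIdeal),
      (1 - χ₀ v * ((Ideal.absNorm v.asIdeal : ℕ) : ℂ) ^ (-s))
  differentiable : Differentiable ℂ L
  L_eq : ∀ s : ℂ, 1 < s.re → L s = rayClassLSeries 𝔣 χ₀ s

namespace RayClassPrimitiveData

variable {𝔪 : Ideal (𝓞 K)} {ψ : HeightOneSpectrum (𝓞 K) → ℂ}

/-- **Existence of the primitive data** for a ray class character `mod 𝔪 ≠ 0`, non-principal on the primes
`∤ 𝔪` (primitive associate: Neukirch VII §6; entire continuation: Hecke, Neukirch VII (8.5)).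
[cite: NeukirchANT1999, Ch. VII §8 Thm. (8.5)] -/
theorem nonempty (hψ : IsRayClassCharacter 𝔪 ψ) (h𝔪 : 𝔪 ≠ ⊥)
    (hnt : ∃ v : HeightOneSpectrum (𝓞 K), ¬ 𝔪 ≤ v.asIdeal ∧ ψ v ≠ 1) : Nonempty (RayClassPrimitiveData 𝔪 ψ) := by
  obtain ⟨𝔣, χ₀, p, h𝔪𝔣, h𝔣, hχ₀, hprim, hp₀, -, hagree, hL⟩ := exists_primitive_associate hψ h𝔪
  obtain ⟨v₀, hv₀, hv₀1⟩ := hnt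
  have hnt₀ : ∃ v : HeightOneSpectrum (𝓞 K), ¬ 𝔣 ≤ v.asIdeal ∧ χ₀ v ≠ 1 :=
    ⟨v₀, fun h ↦ hv₀ (h𝔪𝔣.trans h), by rw [hagree v₀ hv₀]; exact hv₀1⟩
  obtain ⟨L, hLd, hLs, -⟩ := exists_continuation_norm_le hχ₀ hprim hp₀ h𝔣 hnt₀
  exact ⟨⟨𝔣, χ₀, p, L, h𝔪, h𝔪𝔣, h𝔣, hχ₀, hprim, hp₀, hagree, fun s hs ↦ hL s hs, hLd, hLs⟩⟩

variable (D : RayClassPrimitiveData 𝔪 ψ)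

/-- `N𝔣 ≤ N𝔪`. [cite: NeukirchANT1999, Ch. VII §8 Thm. (8.5)] -/
theorem absNorm_le : ((Ideal.absNorm D.𝔣 : ℕ) : ℝ) ≤ (Ideal.absNorm 𝔪 : ℕ) := by
  have hdvd : Ideal.absNorm D.𝔣 ∣ Ideal.absNorm 𝔪 := map_dvd Ideal.absNorm (Ideal.dvd_iff_le.mpr D.le)
  have hm0 : Ideal.absNorm 𝔪 ≠ 0 := by rw [Ne, Ideal.absNorm_eq_zero_iff]; exact D.modulus_ne_bot
  exact_mod_cast Nat.le_of_dvd (Nat.pos_of_ne_zero hm0) hdvd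

/-- Non-principality transfers to the primitive associate. [cite: NeukirchANT1999, Ch. VII §8 Thm. (8.5)] -/
theorem nontrivial (hnt : ∃ v : HeightOneSpectrum (𝓞 K), ¬ 𝔪 ≤ v.asIdeal ∧ ψ v ≠ 1) :
    ∃ v : HeightOneSpectrum (𝓞 K), ¬ D.𝔣 ≤ v.asIdeal ∧ D.χ₀ v ≠ 1 := by
  obtain ⟨v₀, hv₀, hv₀1⟩ := hnt
  exact ⟨v₀, fun h ↦ hv₀ (D.le.trans h), by rw [D.agree v₀ hv₀]; exact hv₀1⟩

/-- `|χ₀(𝔭)| ≤ 1` off `𝔣`. [cite: NeukirchANT1999, Ch. VII §8 Thm. (8.5)] -/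
theorem norm_le_one : ∀ v : HeightOneSpectrum (𝓞 K), ¬ D.𝔣 ≤ v.asIdeal → ‖D.χ₀ v‖ ≤ 1 :=
  fun v hv ↦ (D.isRayClassCharacter.norm_eq_one v hv).le

/-- **`L(s) ≠ 0` for `Re s ≥ 1`** (Euler product for `Re s > 1`; Hecke–Landau on `Re s = 1`).
[cite: ThornerZaman2017, Lemma 5.3] -/
theorem L_ne_zero_of_one_le_re (hnt : ∃ v : HeightOneSpectrum (𝓞 K), ¬ 𝔪 ≤ v.asIdeal ∧ ψ v ≠ 1)
    {s : ℂ} (hs : 1 ≤ s.re) : D.L s ≠ 0 := by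
  rcases eq_or_lt_of_le hs with h | h
  · exact rayClassLSeries_entire_apply_ne_zero_of_re_eq_one D.ne_bot D.isRayClassCharacter (D.nontrivial hnt)
      D.differentiable D.L_eq h.symm
  · intro h0
    have hb := exp_neg_finrank_div_le_norm_rayClassLSeries D.ne_bot D.norm_le_one h
    rw [← D.L_eq s h, h0, norm_zero] at hb
    exact absurd hb (not_le.mpr (Real.exp_pos _))

/-- Every zero of `L` has `Re ρ < 1`. [cite: ThornerZaman2017, Lemma 5.3] -/
theorem re_lt_one_of_zero (hnt : ∃ v : HeightOneSpectrum (𝓞 K), ¬ 𝔪 ≤ v.asIdeal ∧ ψ v ≠ 1)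
    {ρ : ℂ} (hρ : D.L ρ = 0) : ρ.re < 1 := by
  by_contra h
  exact D.L_ne_zero_of_one_le_re hnt (not_lt.mp h) hρ

/-- `L(2 + iv) ≠ 0`. [cite: ThornerZaman2017, Lemma 5.3] -/
theorem L_two_add_ne_zero (hnt : ∃ v : HeightOneSpectrum (𝓞 K), ¬ 𝔪 ≤ v.asIdeal ∧ ψ v ≠ 1) (v : ℝ) :
    D.L (2 + (v : ℂ) * I) ≠ 0 :=
  D.L_ne_zero_of_one_le_re hnt (by simp)

end RayClassPrimitiveData

/-- **The primitive data of `ψ mod 𝔪`, by choice.** [cite: NeukirchANT1999, Ch. VII §8 Thm. (8.5)] -/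
def rayClassPrimitiveData {𝔪 : Ideal (𝓞 K)} {ψ : HeightOneSpectrum (𝓞 K) → ℂ} (hψ : IsRayClassCharacter 𝔪 ψ)
    (h𝔪 : 𝔪 ≠ ⊥) (hnt : ∃ v : HeightOneSpectrum (𝓞 K), ¬ 𝔪 ≤ v.asIdeal ∧ ψ v ≠ 1) : RayClassPrimitiveData 𝔪 ψ :=
  (RayClassPrimitiveData.nonempty hψ h𝔪 hnt).some

/-! ### Heights -/

variable (K) in
/-- The height `ℳ = log(|d_K| N𝔪) + 3n + n log(|v| + 7)` of the zero counts `mod 𝔪`. [cite: ThornerZaman2017, Lemma 2.5] -/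
def rayDiscBound (𝔪 : Ideal (𝓞 K)) (v : ℝ) : ℝ :=
  Real.log (((NumberField.discr K).natAbs : ℝ) * ((Ideal.absNorm 𝔪 : ℕ) : ℝ)) + 3 * Module.finrank ℚ K +
    Module.finrank ℚ K * Real.log (|v| + 7)

variable (K) in
/-- The height of Lemme A `mod 𝔪`: `ℒ' = (77760(5n+2) + 77760) ℳ`. [cite: Bombieri1987GrandCrible, §6 Lemme A] -/
def rayLemmaAHeight (𝔪 : Ideal (𝓞 K)) (v : ℝ) : ℝ :=
  (77760 * (5 * Module.finrank ℚ K + 2) + 77760) * rayDiscBound K 𝔪 v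

variable {𝔪 : Ideal (𝓞 K)} {ψ : HeightOneSpectrum (𝓞 K) → ℂ}

/-- `|d_K| = natAbs d_K` as reals. [cite: ThornerZaman2017, Lemma 2.5] -/
private theorem abs_discr_eq : |(discr K : ℝ)| = ((NumberField.discr K).natAbs : ℝ) := by
  rw [Nat.cast_natAbs, Int.cast_abs]

/-- The height with `N𝔣 ≤ N𝔪` is at most `ℳ`. [cite: ThornerZaman2017, Lemma 2.5] -/
theorem discBound_cond_le_rayDiscBound {𝔣 : Ideal (𝓞 K)} (h𝔣 : 𝔣 ≠ ⊥)
    (hle : ((Ideal.absNorm 𝔣 : ℕ) : ℝ) ≤ (Ideal.absNorm 𝔪 : ℕ)) (v : ℝ) :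
    Real.log (|(discr K : ℝ)| * (Ideal.absNorm 𝔣 : ℝ)) + 3 * Module.finrank ℚ K +
        Module.finrank ℚ K * Real.log (|v| + 7) ≤ rayDiscBound K 𝔪 v := by
  rw [rayDiscBound, abs_discr_eq]
  have hd : (1 : ℝ) ≤ ((NumberField.discr K).natAbs : ℝ) := by
    exact_mod_cast Int.natAbs_pos.mpr (NumberField.discr_ne_zero K)
  have h𝔣1 : (1 : ℝ) ≤ (Ideal.absNorm 𝔣 : ℝ) := by
    exact_mod_cast Nat.one_le_iff_ne_zero.mpr (by rwa [ne_eq, Ideal.absNorm_eq_zero_iff])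
  have h1 : Real.log (((NumberField.discr K).natAbs : ℝ) * (Ideal.absNorm 𝔣 : ℝ)) ≤
      Real.log (((NumberField.discr K).natAbs : ℝ) * ((Ideal.absNorm 𝔪 : ℕ) : ℝ)) :=
    Real.log_le_log (by positivity) (mul_le_mul_of_nonneg_left hle (by positivity))
  linarith

/-- `1 ≤ ℳ`. [cite: ThornerZaman2017, Lemma 2.5] -/
theorem one_le_rayDiscBound (h𝔪 : 𝔪 ≠ ⊥) (v : ℝ) : 1 ≤ rayDiscBound K 𝔪 v := by
  rw [rayDiscBound]
  have hd : (1 : ℝ) ≤ ((NumberField.discr K).natAbs : ℝ) := by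
    exact_mod_cast Int.natAbs_pos.mpr (NumberField.discr_ne_zero K)
  have hm : (1 : ℝ) ≤ ((Ideal.absNorm 𝔪 : ℕ) : ℝ) := by
    exact_mod_cast Nat.one_le_iff_ne_zero.mpr (by rwa [ne_eq, Ideal.absNorm_eq_zero_iff])
  have h1 : 0 ≤ Real.log (((NumberField.discr K).natAbs : ℝ) * ((Ideal.absNorm 𝔪 : ℕ) : ℝ)) :=
    Real.log_nonneg (by nlinarith)
  have h2 : 0 ≤ Real.log (|v| + 7) := Real.log_nonneg (by linarith [abs_nonneg v])
  have hn : (1 : ℝ) ≤ Module.finrank ℚ K := by exact_mod_cast Module.finrank_pos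
  nlinarith

/-- `log|d_K| + log 4 ≤ ℳ` (`log 4 ≤ 3 ≤ 3n`). [cite: ThornerZaman2017, Lemma 2.5] -/
theorem log_discr_add_log_four_le_rayDiscBound (h𝔪 : 𝔪 ≠ ⊥) (v : ℝ) :
    Real.log ((NumberField.discr K).natAbs : ℝ) + Real.log 4 ≤ rayDiscBound K 𝔪 v := by
  rw [rayDiscBound]
  have h1 : (1 : ℝ) ≤ Module.finrank ℚ K := by exact_mod_cast Module.finrank_pos (R := ℚ) (M := K)
  have h4 : Real.log 4 ≤ 3 := by
    rw [show (4 : ℝ) = 2 ^ 2 by norm_num, Real.log_pow]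
    have := Real.log_two_lt_d9; norm_num at this ⊢; linarith
  have hd : (0 : ℝ) < ((NumberField.discr K).natAbs : ℝ) := by
    exact_mod_cast Int.natAbs_pos.mpr (NumberField.discr_ne_zero K)
  have hm : (1 : ℝ) ≤ ((Ideal.absNorm 𝔪 : ℕ) : ℝ) := by
    exact_mod_cast Nat.one_le_iff_ne_zero.mpr (by rwa [ne_eq, Ideal.absNorm_eq_zero_iff])
  have h2 : Real.log ((NumberField.discr K).natAbs : ℝ) ≤
      Real.log (((NumberField.discr K).natAbs : ℝ) * ((Ideal.absNorm 𝔪 : ℕ) : ℝ)) :=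
    Real.log_le_log hd (le_mul_of_one_le_right hd.le hm)
  have h3 : 0 ≤ Real.log (|v| + 7) := Real.log_nonneg (by linarith [abs_nonneg v])
  nlinarith

/-- `ℳ ≤ ℒ'` and `1 ≤ ℒ'`. [cite: Bombieri1987GrandCrible, §6 Lemme A] -/
theorem rayDiscBound_le_rayLemmaAHeight (h𝔪 : 𝔪 ≠ ⊥) (v : ℝ) : rayDiscBound K 𝔪 v ≤ rayLemmaAHeight K 𝔪 v := by
  rw [rayLemmaAHeight]
  have h := one_le_rayDiscBound (K := K) h𝔪 v
  have : (1 : ℝ) ≤ 77760 * (5 * Module.finrank ℚ K + 2) + 77760 := by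
    have : (0 : ℝ) ≤ Module.finrank ℚ K := Nat.cast_nonneg _
    nlinarith
  nlinarith

/-! ### Local data of `L` on the discs `|s − (2 + iv)| ≤ 2` -/

namespace RayClassPrimitiveData

variable (D : RayClassPrimitiveData 𝔪 ψ)

/-- **Jensen**: `Σ_{|ρ−c| ≤ 31/16} m(ρ) ≤ 32 ℳ` for the zeros of `L` (tree `sum_divisor_continuation_bigDisc_le`).
[cite: ThornerZaman2017, Lemma 2.5] -/
theorem sum_discDivisor_le (hnt : ∃ v : HeightOneSpectrum (𝓞 K), ¬ 𝔪 ≤ v.asIdeal ∧ ψ v ≠ 1) (v : ℝ) :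
    ∑ ρ ∈ discZeros D.L v, (discDivisor D.L v ρ : ℝ) ≤ 32 * rayDiscBound K 𝔪 v := by
  have h := sum_divisor_continuation_bigDisc_le D.isRayClassCharacter D.isPrimitive D.isSignType D.ne_bot
    (D.nontrivial hnt) D.differentiable D.L_eq v
  refine h.trans (mul_le_mul_of_nonneg_left
    (discBound_cond_le_rayDiscBound D.ne_bot D.absNorm_le v) (by norm_num))

/-- **The local partial fraction**: `|L'/L(s) − Σ_{|ρ−c| ≤ 31/16} m(ρ)/(s−ρ)| ≤ 77760 ℳ` for `|s − c| ≤ 7/4`,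
`L(s) ≠ 0` (Lagarias–Odlyzko Lemma 5.6; tree `norm_logDeriv_continuation_sub_sum_le`). [cite: LagariasOdlyzko1977, Lemma 5.6] -/
theorem norm_logDeriv_sub_sum_le (hnt : ∃ v : HeightOneSpectrum (𝓞 K), ¬ 𝔪 ≤ v.asIdeal ∧ ψ v ≠ 1) (v : ℝ)
    {s : ℂ} (hs : s ∈ closedBall (2 + (v : ℂ) * I) (7 / 4)) (hfs : D.L s ≠ 0) :
    ‖logDeriv D.L s - ∑ ρ ∈ discZeros D.L v, (discDivisor D.L v ρ : ℂ) / (s - ρ)‖ ≤ 77760 * rayDiscBound K 𝔪 v := by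
  have h := norm_logDeriv_continuation_sub_sum_le D.isRayClassCharacter D.isPrimitive D.isSignType D.ne_bot
    (D.nontrivial hnt) D.differentiable D.L_eq v hs hfs
  refine h.trans (mul_le_mul_of_nonneg_left
    (discBound_cond_le_rayDiscBound D.ne_bot D.absNorm_le v) (by norm_num))

/-- **`|L'/L(s)| ≤ 1/(σ − 1) + 77760(5n+2)(log|d_K| + log 4)`** for `1 < σ ≤ 2` (tree
`norm_logDeriv_continuation_le_of_one_lt_re`). [cite: LagariasOdlyzko1977, §5 (5.3)] -/
theorem norm_logDeriv_le {s : ℂ} (hs : 1 < s.re) (hs2 : s.re ≤ 2) :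
    ‖logDeriv D.L s‖ ≤ 1 / (s.re - 1) + 77760 * (5 * Module.finrank ℚ K + 2) *
      (Real.log ((discr K).natAbs : ℝ) + Real.log 4) :=
  norm_logDeriv_continuation_le_of_one_lt_re D.ne_bot D.norm_le_one D.L_eq hs hs2

/-- **Lemme de densité for `L`**: for `0 < λ ≤ 1/4`, `Σ_{|ρ−(1+iv)| ≤ λ} m(ρ) ≤ 4(1 + λℒ')`.
[cite: Bombieri1987GrandCrible, §6 Lemme de densité] -/
theorem localCount_le (hnt : ∃ v : HeightOneSpectrum (𝓞 K), ¬ 𝔪 ≤ v.asIdeal ∧ ψ v ≠ 1) (v : ℝ) {lam : ℝ}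
    (hlam : 0 < lam) (hlam4 : lam ≤ 1 / 4) :
    ∑ ρ ∈ (discZeros D.L v).filter (fun ρ => ‖ρ - (1 + (v : ℂ) * I)‖ ≤ lam),
        (discDivisor D.L v ρ : ℝ) ≤ 4 * (1 + lam * rayLemmaAHeight K 𝔪 v) := by
  set f := D.L with hf
  set s : ℂ := ((1 + lam : ℝ) : ℂ) + (v : ℂ) * I with hs
  have hsre : s.re = 1 + lam := by simp [hs]
  have hs1 : 1 < s.re := by rw [hsre]; linarith
  have hs2 : s.re ≤ 2 := by rw [hsre]; linarith
  have hsmem : s ∈ closedBall (2 + (v : ℂ) * I) (7 / 4) := by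
    rw [mem_closedBall, dist_eq_norm]
    have : s - (2 + (v : ℂ) * I) = ((lam - 1 : ℝ) : ℂ) := by rw [hs]; push_cast; ring
    rw [this, Complex.norm_real, Real.norm_eq_abs, abs_of_nonpos (by linarith)]; linarith
  have hfs : f s ≠ 0 := D.L_ne_zero_of_one_le_re hnt hs1.le
  have hpf := D.norm_logDeriv_sub_sum_le hnt v hsmem hfs
  have hld := D.norm_logDeriv_le hs1 hs2
  rw [hsre, show (1 : ℝ) + lam - 1 = lam by ring] at hld
  have hre : ∀ ρ ∈ discZeros f v, ρ.re ≤ 1 := by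
    intro ρ hρ
    have h0 := ((mem_discZeros D.differentiable (D.L_two_add_ne_zero hnt v)).1 hρ).2
    exact (D.re_lt_one_of_zero hnt h0).le
  have h := sum_near_le D.differentiable hlam hre hpf hld
  refine h.trans ?_
  have hℓ := log_discr_add_log_four_le_rayDiscBound (K := K) D.modulus_ne_bot v
  have hℒ0 : 0 ≤ rayDiscBound K 𝔪 v := le_trans zero_le_one (one_le_rayDiscBound D.modulus_ne_bot v)
  have hn : (0 : ℝ) ≤ Module.finrank ℚ K := Nat.cast_nonneg _
  have hK₀ : 0 ≤ 77760 * (5 * (Module.finrank ℚ K : ℝ) + 2) := by positivity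
  have key : 77760 * (5 * (Module.finrank ℚ K : ℝ) + 2) * (Real.log ((NumberField.discr K).natAbs : ℝ) + Real.log 4) +
      77760 * rayDiscBound K 𝔪 v ≤ rayLemmaAHeight K 𝔪 v := by
    rw [rayLemmaAHeight]
    nlinarith
  nlinarith

end RayClassPrimitiveData

/-! ### Lemme A -/

/-- **Bombieri's Lemme A for the Hecke `L`-function of a ray class character**, uniformly in the number field,
the modulus and the character: there is an absolute `c₄ > 0` such that for every number field `K`, modulus
`𝔪 ≠ 0`, ray class character `ψ mod 𝔪` non-principal on the primes `∤ 𝔪`, primitive data `D` (entire `L`),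
all real `v` and `0 < r` with `512 r ≤ 1/8`, `rL' ≥ 1`, `L' ≥ ℒ' = rayLemmaAHeight K 𝔪 v`: if `L` has a zero
`ρ₀` with `|ρ₀ − (1 + iv)| ≤ r`, then for every natural `K' ≥ c₄ rL' + 2` there is `k ∈ [K', 2K']` with
`e^{−10K'} (2r)^{−(k+1)} ≤ ‖(L'/L)^{(k)}(1 + r + iv)‖/k!`. [cite: Bombieri1987GrandCrible, §6 Lemme A] -/
theorem lemmeA_rayClass :
    ∃ c₄ : ℝ, 0 < c₄ ∧ ∀ (K : Type*) [Field K] [NumberField K] (𝔪 : Ideal (𝓞 K))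
      (ψ : HeightOneSpectrum (𝓞 K) → ℂ) (D : RayClassPrimitiveData 𝔪 ψ),
      (∃ v : HeightOneSpectrum (𝓞 K), ¬ 𝔪 ≤ v.asIdeal ∧ ψ v ≠ 1) →
      ∀ (v r L' : ℝ), rayLemmaAHeight K 𝔪 v ≤ L' → 0 < r → 512 * r ≤ 1 / 8 → 1 ≤ r * L' →
        (∃ ρ₀ : ℂ, D.L ρ₀ = 0 ∧ ‖ρ₀ - (1 + (v : ℂ) * I)‖ ≤ r) →
        ∀ K' : ℕ, c₄ * (r * L') + 2 ≤ K' →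
          ∃ k ∈ Finset.Icc K' (2 * K'),
            Real.exp (-(10 * K')) * (2 * r)⁻¹ ^ (k + 1) ≤
              ‖iteratedDeriv k (logDeriv D.L) (((1 + r : ℝ) : ℂ) + (v : ℂ) * I)‖ / k.factorial := by
  obtain ⟨c₄, hc₄, h⟩ := lemmeA_abstract (C_d := 4) (C_J := 1) (C₁ := 1) (by norm_num) one_pos one_pos
  refine ⟨c₄, hc₄, fun K _ _ 𝔪 ψ D hnt v r L' hL hr hr8 hu hzero K' hK' ↦ ?_⟩
  set f := D.L with hf
  have h𝔪 : 𝔪 ≠ ⊥ := D.modulus_ne_bot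
  have hdf : Differentiable ℂ f := D.differentiable
  have hfc : f (2 + (v : ℂ) * I) ≠ 0 := D.L_two_add_ne_zero hnt v
  set s₀ : ℂ := ((1 + r : ℝ) : ℂ) + (v : ℂ) * I with hs₀
  have hr0 : r ≤ 1 / 4096 := by linarith
  have hs₀re : s₀.re = 1 + r := by simp [hs₀]
  have hs₀1 : 1 < s₀.re := by rw [hs₀re]; linarith
  have hfs₀ : f s₀ ≠ 0 := D.L_ne_zero_of_one_le_re hnt hs₀1.le
  have hs₀mem : s₀ ∈ closedBall (2 + (v : ℂ) * I) (3 / 2) := by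
    rw [mem_closedBall, dist_eq_norm]
    have : s₀ - (2 + (v : ℂ) * I) = ((r - 1 : ℝ) : ℂ) := by rw [hs₀]; push_cast; ring
    rw [this, Complex.norm_real, Real.norm_eq_abs, abs_of_nonpos (by linarith)]; linarith
  have hℒd := rayDiscBound_le_rayLemmaAHeight (K := K) h𝔪 v
  have hℒ0 : 0 ≤ rayDiscBound K 𝔪 v := le_trans zero_le_one (one_le_rayDiscBound h𝔪 v)
  have hn : (0 : ℝ) ≤ Module.finrank ℚ K := Nat.cast_nonneg _
  refine h (discZeros f v) (discDivisor f v) (fun k ↦ iteratedDeriv k (logDeriv f) s₀) v r L'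
    hr hr8 hu (fun ρ ↦ discDivisor_nonneg hdf v ρ) ?_ ?_ ?_ ?_ ?_ K' hK'
  · intro ρ hρ
    have hmem := (mem_discZeros hdf hfc).1 hρ
    exact ⟨D.re_lt_one_of_zero hnt hmem.2, by exact_mod_cast one_le_discDivisor hdf hfc hρ⟩
  · intro lam hlam hlam4
    refine (D.localCount_le hnt v hlam hlam4).trans ?_
    have := mul_le_mul_of_nonneg_left hL hlam.le
    nlinarith
  · calc ∑ ρ ∈ discZeros f v, (discDivisor f v ρ : ℝ) ≤ 32 * rayDiscBound K 𝔪 v := D.sum_discDivisor_le hnt v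
      _ ≤ 1 * L' := by
          rw [one_mul]
          refine le_trans ?_ hL
          rw [rayLemmaAHeight]
          nlinarith
  · intro k
    have hpf : ∀ z ∈ closedBall (2 + (v : ℂ) * I) (7 / 4), f z ≠ 0 →
        ‖logDeriv f z - ∑ ρ ∈ discZeros f v, (discDivisor f v ρ : ℂ) / (z - ρ)‖ ≤ 77760 * rayDiscBound K 𝔪 v :=
      fun z hz hfz ↦ D.norm_logDeriv_sub_sum_le hnt v hz hfz
    have hE : (0 : ℝ) ≤ 77760 * rayDiscBound K 𝔪 v := by positivity
    have hC := norm_iteratedDeriv_logDeriv_sub_le hdf hfc hE hpf hs₀mem hfs₀ k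
    refine hC.trans ?_
    have hfac : (0 : ℝ) ≤ k.factorial * 16 ^ k := by positivity
    calc (k.factorial : ℝ) * 16 ^ k * (77760 * rayDiscBound K 𝔪 v) ≤ k.factorial * 16 ^ k * (1 * L') := by
          refine mul_le_mul_of_nonneg_left ?_ hfac
          rw [one_mul]
          refine le_trans ?_ hL
          rw [rayLemmaAHeight]
          nlinarith
      _ = _ := by ring
  · obtain ⟨ρ₀, hρ₀, hρ₀r⟩ := hzero
    refine ⟨ρ₀, (mem_discZeros hdf hfc).2 ⟨?_, hρ₀⟩, hρ₀r⟩
    rw [mem_closedBall, dist_eq_norm]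
    calc ‖ρ₀ - (2 + (v : ℂ) * I)‖ = ‖(ρ₀ - (1 + (v : ℂ) * I)) + (-1 : ℂ)‖ := by ring_nf
      _ ≤ ‖ρ₀ - (1 + (v : ℂ) * I)‖ + ‖(-1 : ℂ)‖ := norm_add_le _ _
      _ ≤ r + 1 := by rw [norm_neg, norm_one]; linarith
      _ ≤ 31 / 16 := by linarith

end Literature.NumberTheory.LFunctions

end
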